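import Summits.Ventures.HodgeRepro2.T6A2WeilLangeCorner
import Summits.Ventures.HodgeRepro2.T6A1HostOrder

/-!
# T6A2WeilOrder — the `OrderAction` datum of the corner product, from the host's order and t6-p1's `phiW`

Cell pub-hodge-repro2, Tier 6 (README §10), seat t6-p2 (A2 host side; seam ruling STATUS l. 10912 (2)(v)).
The binder `A : OrderAction Bd.W (cornerSPVar C) K` of `transferShadowWeil` (T6A2WeilIdent) is a constructor
of host data: the common order `C.O'` of the corner product, its diagonal action `C.endo` read as morphisms of
schemes (`avHom`), the order property `C.exists_natCast_mul_mem` (T6Host v4), and the rational identification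
`φ₁ := phiW Bd C hT hcA hcB h17 : H1 K ≃ₗ[ℚ] Bd.W.obj C.B.X 1` of t6-p1 (T6A1HostOrder) with its
equivariance `phiW_act_endo`. The seam `hφ` of T6A2WeilHalg (`φ₁ (h1ToC w) = 1 ⊗ isoObj (A.φ₁ w)` for t6-p1's
complex dictionary `phi`) is t6-p1's `mk_one_phiQ` read through `phiW = phiQEquiv.trans isoObj.symm`.
No display is consumed here; no `sorry`; standard axioms. §8(d): uses an L-value-free non-vanishing device: NO.
-/

noncomputable section

namespace Summit.Ventures.HodgeRepro2.T6.WeilOrder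

open CategoryTheory
open scoped TensorProduct
open HostAPI.Carriers.AlgebraicGeometry.Motives
open Summit.Ventures.HodgeRepro2.T6 Host WeilInst WeilLange A1Dict A1HostBetti A1HostOrder

variable {K : Type} [Field K] [NumberField K] [NumberField.IsCMField K] (Bd : BettiHodgeData ℂ)
  (C : CornerProduct K)
  (hT : ∀ (i : Fin 4) (σ : K →+* ℂ), σ ∈ C.F.T i ↔ eigC (C.A i).act σ ≤ hodgeHC Bd (C.A i).smooth 1 1 0)
  (hcA : ∀ i, IsCompl (hodgeHC Bd (C.A i).smooth 1 1 0) (hodgeHC Bd (C.A i).smooth 1 0 1))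
  (hcB : IsCompl (hodgeHC Bd C.smooth 1 1 0) (hodgeHC Bd C.smooth 1 0 1)) (h17 : Lemma1117Q)

/-- **THE `OrderAction` DATUM OF THE CORNER PRODUCT**: the common order `C.O'` acting by the diagonal
endomorphisms `C.endo`, with t6-p1's rational dictionary `phiW` as `φ₁`. -/
def orderActionW : OrderAction Bd.W (cornerSPVar C) K where
  O' := C.O'
  endo x hx := avHom (C.endo ⟨x, hx⟩)
  exists_natCast_mul_mem := C.exists_natCast_mul_mem
  φ₁ := phiW Bd C hT hcA hcB h17
  φ₁_act x hx v := phiW_act_endo Bd C hT hcA hcB h17 ⟨x, hx⟩ v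

/-- the `φ₁` of `orderActionW` is t6-p1's `phiW` -/
theorem orderActionW_φ₁ : (orderActionW Bd C hT hcA hcB h17).φ₁ = phiW Bd C hT hcA hcB h17 := rfl

/-- `isoObj ∘ phiW = phiQ` (the rational dictionary on the host's `H¹(B(ℂ), ℚ)`) -/
theorem isoObj_phiW (w : H1 K) :
    Bd.isoObj C.B.X 1 (phiW Bd C hT hcA hcB h17 w) = phiQ Bd C hT hcA hcB h17 w := by
  simp only [phiW, LinearEquiv.trans_apply, LinearEquiv.apply_symm_apply]
  rfl

/-- **THE SEAM `hφ` OF T6A2WeilHalg / T6A2WeilLef2**: t6-p1's complex dictionary `phi` on a rational model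
class is `1 ⊗ isoObj` of `orderActionW`'s `φ₁` (t6-p1's `mk_one_phiQ`). -/
theorem phi_h1ToC_eq_tmul (w : H1 K) :
    (factorIdentHC Bd C hT hcA hcB h17).phi C.F.deg6 (h1ToC K w) =
      (1 : ℂ) ⊗ₜ[ℚ] Bd.isoObj C.B.X 1 ((orderActionW Bd C hT hcA hcB h17).φ₁ w) := by
  rw [orderActionW_φ₁, isoObj_phiW, mk_one_phiQ]

end Summit.Ventures.HodgeRepro2.T6.WeilOrder

end
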